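import Summits.AtomisticToContinuum.HydrodynamicLimit.Theorems.JParityClosureAssemblySpeedJumpWindow

/-!
# Route JParityClosure — `Assembly` (stmt-AtomisticToContinuum-17595): the windowed speed-jump bound
# `hstat` FROM `EvenStressEnskog`, the density cap, the packing guard and energy tightness

Companion of `JParityClosureAssemblySpeedJumpWindow.lean` (pathwise domination):
* `abs_enskogRate_le`, `abs_integral_enskogRate_le` — the Enskog term of the crux statistic for
  `Ξ_P^{kk}`, a time weight `|χ| ≤ 𝟙_{[a,b]}` and a cutoff with `|g·Y| ≤ C_Y`, is at most
  `C_Y·4|S²|ρ_b·2K·(b − a)` along an orbit with mollified densities `≤ ρ_b` and energy per particle `≤ K`;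
* `hstat_of_evenStat_of_cap` — **the hypothesis `hstat` of `hequi_momentum_localGibbs`** from the inner
  statements of `EvenStressEnskog` (vocabulary `evenStat`, `Iff.rfl`) and `DensityCap` (vocabulary
  `mollDensity`) at the given `σ` and flows, a bound + the packing guard `ρσ³ ≤ η₀/2` for the Euler density
  on `[0, t']`, a bound `C_Y` for the contact value on `[0, η₀]` (analytic band of `HsEosLowDensity`) and
  energy tightness: a continuous time bump (`exists_bump`) and density cutoff (`exists_cutoff`) are fed to
  the crux; on the capped, energy-bounded, ESE-good event the statistic is
  `≤ ½Σ_k collisionSum_k ≤ ½Σ_k(|evenStat_k| + σ³|∫enskogRate_k|) < η`;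
* `hequi_momentum_of_evenStat_of_cap` — the momentum `hequi` of the fixed-time upgrade with `hstat`
  discharged: the momentum third of the conclusion at a fixed instant needs from the route ONLY
  `EvenStressEnskog`, `DensityCap`, the guard and the time-averaged identification. No new objects.
-/

noncomputable section

namespace Summit.AtomisticToContinuum.HydrodynamicLimit.Theorems.JParityClosureSpeedJumpWindow

open Set MeasureTheory Filter Topology Function
open scoped ENNReal InnerProductSpace
open Literature.Analysis.FluidPDE Literature.Analysis.FunctionSpaces
open Literature.MathematicalPhysics.KineticTheory
open Summit.AtomisticToContinuum.HydrodynamicLimit.Theorems.JParityClosureMomentumModulus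

/-! ### The Enskog term along a capped, energy-bounded orbit -/

/-- **Enskog rate functional of `Ξ_P^{kk}` at one configuration** (mollified densities `≤ ρ_b`,
`|χ(s, ·)| ≤ c_s`, `|g·Y| ≤ C_Y`, `0 < r ≤ 1/2`): `|e_s(w)| ≤ c_s C_Y (4|S²|ρ_b) · 2E_kin(w)/(N+1)`. [folklore] -/
theorem abs_enskogRate_le {σ : ℝ} (hσ : 0 ≤ σ) {N : ℕ} (k : Fin 3) {χ : ℝ × UnitAddTorus (Fin 3) → ℝ}
    {g : ℝ → ℝ} {r : ℝ} (hr : 0 < r) (hr2 : r ≤ 1 / 2) {s cs : ℝ} (hcs : 0 ≤ cs)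
    (hχ : ∀ x, |χ (s, x)| ≤ cs) {CY : ℝ} (hgY : ∀ a, 0 ≤ a → |g a * contactValue a| ≤ CY)
    {ρb : ℝ} (w : Config (N + 1) (Fin 3) T3) (hcap : ∀ x, mollDensity r w x ≤ ρb) :
    |enskogRate σ N χ g (evenMark k k) r s w| ≤
      cs * CY * (4 * (sphereMeasure : Measure (Metric.sphere (0 : V3) 1)).real univ * ρb) *
        ((((N + 1 : ℕ) : ℝ))⁻¹ * (2 * configEnergy w)) := by
  set CS : ℝ := (sphereMeasure : Measure (Metric.sphere (0 : V3) 1)).real univ with hCS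
  have hCS0 : 0 ≤ CS := measureReal_nonneg
  have hCY0 : 0 ≤ CY := (abs_nonneg _).trans (hgY 0 le_rfl)
  set eR : T3 → ℝ := fun x => (((N + 1 : ℕ) : ℝ))⁻¹ * ∑ j, coneKernel r (w j).1 x * ‖(w j).2‖ ^ 2 with heR
  have heR0 : ∀ x, 0 ≤ eR x := fun x => mul_nonneg (by positivity)
    (Finset.sum_nonneg fun j _ => mul_nonneg (DensityCapNegative.cone_nonneg hr (w j).1 x) (sq_nonneg _))
  have hρb0 : 0 ≤ ρb := (mollDensity_nonneg_of_pos hr w 0).trans (hcap 0)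
  have heR_int : Integrable eR volume := by
    refine Integrable.const_mul (integrable_finsetSum _ fun j _ => Integrable.mul_const ?_ _) _
    refine Continuous.integrable_of_hasCompactSupport ?_ (HasCompactSupport.of_compactSpace _)
    unfold coneKernel
    exact continuous_const.mul ((continuous_const.sub
      ((Torus.continuous_euclidDist.comp (continuous_const.prodMk continuous_id)).div_const r)).max
        continuous_const)
  have hpF0 : ∀ x, 0 ≤ pairFunctional r (evenMark k k) w x := by
    intro x
    rw [pairFunctional_eq_double_sum]
    refine mul_nonneg (by positivity) (Finset.sum_nonneg fun i _ => Finset.sum_nonneg fun j _ => ?_)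
    refine mul_nonneg (mul_nonneg (DensityCapNegative.cone_nonneg hr _ _)
      (DensityCapNegative.cone_nonneg hr _ _)) (integral_nonneg fun ω => ?_)
    exact mul_nonneg (mul_nonneg (le_max_right _ _) (mul_self_nonneg _)) (hardSphereKernel_nonneg_le _ _ ω).1
  have hbound : ∀ x, ‖χ (s, x) * g (σ ^ 3 * mollDensity r w x) * contactValue (σ ^ 3 * mollDensity r w x) *
      pairFunctional r (evenMark k k) w x‖ ≤ cs * CY * (4 * CS * ρb) * eR x := by
    intro x
    have ha : 0 ≤ σ ^ 3 * mollDensity r w x := mul_nonneg (pow_nonneg hσ 3) (mollDensity_nonneg_of_pos hr w x)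
    have hpF : pairFunctional r (evenMark k k) w x ≤ 4 * CS * ρb * eR x := by
      refine (pairFunctional_evenMark_diag_le k hr w x).trans ?_
      have : 4 * CS * mollDensity r w x ≤ 4 * CS * ρb := mul_le_mul_of_nonneg_left (hcap x) (by positivity)
      exact mul_le_mul_of_nonneg_right this (heR0 x)
    rw [Real.norm_eq_abs, show χ (s, x) * g (σ ^ 3 * mollDensity r w x) *
        contactValue (σ ^ 3 * mollDensity r w x) * pairFunctional r (evenMark k k) w x =
        χ (s, x) * ((g (σ ^ 3 * mollDensity r w x) * contactValue (σ ^ 3 * mollDensity r w x)) *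
          pairFunctional r (evenMark k k) w x) by ring, abs_mul, abs_mul, abs_of_nonneg (hpF0 x)]
    calc |χ (s, x)| * (|g (σ ^ 3 * mollDensity r w x) * contactValue (σ ^ 3 * mollDensity r w x)| *
          pairFunctional r (evenMark k k) w x)
        ≤ cs * (CY * (4 * CS * ρb * eR x)) :=
          mul_le_mul (hχ x) (mul_le_mul (hgY _ ha) hpF (hpF0 x) hCY0)
            (mul_nonneg (abs_nonneg _) (hpF0 x)) hcs
      _ = cs * CY * (4 * CS * ρb) * eR x := by ring
  unfold enskogRate
  calc |∫ x, χ (s, x) * g (σ ^ 3 * mollDensity r w x) * contactValue (σ ^ 3 * mollDensity r w x) *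
          pairFunctional r (evenMark k k) w x|
      ≤ ∫ x, cs * CY * (4 * CS * ρb) * eR x := by
        rw [← Real.norm_eq_abs]
        exact norm_integral_le_of_norm_le (heR_int.const_mul _) (ae_of_all _ hbound)
    _ = cs * CY * (4 * CS * ρb) * ((((N + 1 : ℕ) : ℝ))⁻¹ * (2 * configEnergy w)) := by
        rw [integral_const_mul, heR, integral_coneEnergy hr hr2]

/-- **Time-integrated Enskog term along a capped, energy-bounded orbit** (`|χ(s, ·)| ≤ 𝟙_{[a,b]}(s)`,
`|g·Y| ≤ C_Y`, densities `≤ ρ_b` on `[0, τ]`, energy per particle `≤ K`):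
`|∫_{[0,τ]} e_s(Φ_s z) ds| ≤ C_Y (4|S²|ρ_b)(2K)(b − a)`. [folklore] -/
theorem abs_integral_enskogRate_le {σ : ℝ} (hσ : 0 < σ) {N : ℕ}
    (Φ : HardSphereFlow (Torus.geometry (Fin 3)) (hsDiameter σ N) (N + 1)) (k : Fin 3)
    {χ : ℝ × UnitAddTorus (Fin 3) → ℝ} {g : ℝ → ℝ} {r : ℝ} (hr : 0 < r) (hr2 : r ≤ 1 / 2) {τ : ℝ}
    (hτ : 0 ≤ τ) {a b : ℝ} (hab : a ≤ b) (hχ : ∀ s x, |χ (s, x)| ≤ (Icc a b).indicator 1 s)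
    {CY : ℝ} (hgY : ∀ a, 0 ≤ a → |g a * contactValue a| ≤ CY) {ρb K : ℝ} (hK : 0 ≤ K)
    {z : Config (N + 1) (Fin 3) T3} (hcap : ∀ s ∈ Icc 0 τ, ∀ x, mollDensity r (Φ.flow s z) x ≤ ρb)
    (hE : ∀ s, (((N + 1 : ℕ) : ℝ))⁻¹ * configEnergy (Φ.flow s z) ≤ K) :
    |∫ s in Icc (0 : ℝ) τ, enskogRate σ N χ g (evenMark k k) r s (Φ.flow s z)| ≤
      CY * (4 * (sphereMeasure : Measure (Metric.sphere (0 : V3) 1)).real univ * ρb) * (2 * K) * (b - a) := by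
  set CS : ℝ := (sphereMeasure : Measure (Metric.sphere (0 : V3) 1)).real univ with hCS
  have hCY0 : 0 ≤ CY := (abs_nonneg _).trans (hgY 0 le_rfl)
  set C : ℝ := CY * (4 * CS * ρb) * (2 * K) with hC
  have hρb0 : 0 ≤ ρb := (mollDensity_nonneg_of_pos hr (Φ.flow 0 z) 0).trans (hcap 0 ⟨le_rfl, hτ⟩ 0)
  have hC0 : 0 ≤ C := by positivity
  have hpt : ∀ s ∈ Icc (0 : ℝ) τ, ‖enskogRate σ N χ g (evenMark k k) r s (Φ.flow s z)‖ ≤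
      (Icc a b).indicator (fun _ => C) s := by
    intro s hs
    rw [Real.norm_eq_abs]
    have h1 := abs_enskogRate_le hσ.le k hr hr2 (cs := (Icc a b).indicator 1 s)
      (indicator_nonneg (fun _ _ => zero_le_one) s) (fun x => hχ s x) hgY (Φ.flow s z) (hcap s hs)
    refine h1.trans ?_
    by_cases hsab : s ∈ Icc a b
    · simp only [indicator_of_mem hsab, Pi.one_apply, one_mul, hC]
      have := hE s
      have h2 : (((N + 1 : ℕ) : ℝ))⁻¹ * (2 * configEnergy (Φ.flow s z)) ≤ 2 * K := by nlinarith
      exact mul_le_mul_of_nonneg_left h2 (by positivity)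
    · simp only [indicator_of_notMem hsab, zero_mul]
      exact le_rfl
  have hind_int : Integrable (fun s => (Icc a b).indicator (fun _ => C) s) volume :=
    (integrable_indicator_iff measurableSet_Icc).2 (integrableOn_const (by simp [Real.volume_Icc]))
  calc |∫ s in Icc (0 : ℝ) τ, enskogRate σ N χ g (evenMark k k) r s (Φ.flow s z)|
      ≤ ∫ s in Icc (0 : ℝ) τ, (Icc a b).indicator (fun _ => C) s := by
        rw [← Real.norm_eq_abs]
        exact norm_integral_le_of_norm_le hind_int.integrableOn
          ((ae_restrict_iff' measurableSet_Icc).2 (ae_of_all _ hpt))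
    _ ≤ ∫ s, (Icc a b).indicator (fun _ => C) s :=
        setIntegral_le_integral hind_int (ae_of_all _ fun s => indicator_nonneg (fun _ _ => hC0) s)
    _ = C * (b - a) := by
        rw [integral_indicator_const _ measurableSet_Icc, smul_eq_mul, measureReal_def, Real.volume_Icc,
          ENNReal.toReal_ofReal (sub_nonneg.2 hab), mul_comm]

/-! ### The windowed speed-jump bound from the crux, the cap, the guard and energy tightness -/

/-- A continuous time bump: `= 1` on `[t, t + Δ] × 𝕋³`, nonnegative, `|χ| ≤ 𝟙_{[t−Δ, t+2Δ]}`. [folklore] -/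
theorem exists_bump {t Δ : ℝ} (hΔ : 0 < Δ) :
    ∃ χ : ℝ × UnitAddTorus (Fin 3) → ℝ, Continuous χ ∧ (∀ s ∈ Icc t (t + Δ), ∀ x, χ (s, x) = 1) ∧
      (∀ s x, 0 ≤ χ (s, x)) ∧ (∀ s x, |χ (s, x)| ≤ (Icc (t - Δ) (t + 2 * Δ)).indicator 1 s) := by
  refine ⟨fun p => max 0 (min 1 (min ((p.1 - (t - Δ)) / Δ) ((t + 2 * Δ - p.1) / Δ))), by fun_prop,
    fun s hs x => ?_, fun s x => le_max_left _ _, fun s x => ?_⟩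
  · have h1 : 1 ≤ (s - (t - Δ)) / Δ := by rw [le_div_iff₀ hΔ]; linarith [hs.1]
    have h2 : 1 ≤ (t + 2 * Δ - s) / Δ := by rw [le_div_iff₀ hΔ]; linarith [hs.2]
    show max 0 (min 1 (min ((s - (t - Δ)) / Δ) ((t + 2 * Δ - s) / Δ))) = 1
    rw [min_eq_left (le_min h1 h2), max_eq_right zero_le_one]
  · show |max 0 (min 1 (min ((s - (t - Δ)) / Δ) ((t + 2 * Δ - s) / Δ)))| ≤ _
    rw [abs_of_nonneg (le_max_left _ _)]
    by_cases hs : s ∈ Icc (t - Δ) (t + 2 * Δ)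
    · rw [indicator_of_mem hs, Pi.one_apply]
      exact max_le zero_le_one (min_le_left _ _)
    · rw [indicator_of_notMem hs]
      refine max_le le_rfl ?_
      rw [mem_Icc, not_and_or, not_le, not_le] at hs
      rcases hs with hs | hs
      · have : (s - (t - Δ)) / Δ < 0 := div_neg_of_neg_of_pos (by linarith) hΔ
        exact (min_le_right _ _).trans ((min_le_left _ _).trans this.le)
      · have : (t + 2 * Δ - s) / Δ < 0 := div_neg_of_neg_of_pos (by linarith) hΔ
        exact (min_le_right _ _).trans ((min_le_right _ _).trans this.le)

/-- A continuous density cutoff: `= 0` on `[η₀, ∞)`, `= 1` on `(−∞, 3η₀/4]`, values in `[0, 1]`. [folklore] -/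
theorem exists_cutoff {η₀ : ℝ} (hη₀ : 0 < η₀) :
    ∃ g : ℝ → ℝ, Continuous g ∧ (∀ a, η₀ ≤ a → g a = 0) ∧ (∀ a, a ≤ 3 * η₀ / 4 → g a = 1) ∧
      (∀ a, 0 ≤ g a) ∧ (∀ a, g a ≤ 1) := by
  refine ⟨fun a => max 0 (min 1 ((η₀ - a) * (4 / η₀))), by fun_prop, fun a ha => ?_, fun a ha => ?_,
    fun a => le_max_left _ _, fun a => max_le zero_le_one (min_le_left _ _)⟩
  · have : (η₀ - a) * (4 / η₀) ≤ 0 := mul_nonpos_of_nonpos_of_nonneg (by linarith) (by positivity)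
    exact le_antisymm (max_le le_rfl ((min_le_right _ _).trans this)) (le_max_left _ _)
  · have : 1 ≤ (η₀ - a) * (4 / η₀) := by
      rw [mul_div_assoc', le_div_iff₀ hη₀]; linarith
    show max 0 (min 1 ((η₀ - a) * (4 / η₀))) = 1
    rw [min_eq_left this, max_eq_right zero_le_one]

/-- **`hstat` from the crux, the cap, the guard and energy tightness** (`σ > 0`, profiles, flows `Φ`,
`0 ≤ t < t'`; `η₀ > 0` with `|Y| ≤ C_Y` on `[0, η₀]`; `ρ ≤ ρ_max` and `ρσ³ ≤ η₀/2` on `[0, t'] × 𝕋³`;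
`henergy`; `hESE` = inner `EvenStressEnskog` for this `σ, η₀, Φ`; `hcap` = inner `DensityCap` on
`[0, t']`): verbatim the hypothesis `hstat` of `hequi_momentum_localGibbs` at `t`. [folklore] -/
theorem hstat_of_evenStat_of_cap {σ : ℝ} (hσ : 0 < σ) (a₀ θ₀ : T3 → ℝ) (u₀ : T3 → V3)
    (Φ : (N : ℕ) → HardSphereFlow (Torus.geometry (Fin 3)) (hsDiameter σ N) (N + 1))
    (ρ : ℝ → T3 → ℝ) {t t' : ℝ} (ht : 0 ≤ t) (htt' : t < t')
    {η₀ : ℝ} (hη₀ : 0 < η₀) {CY : ℝ} (hY : ∀ a, 0 ≤ a → a ≤ η₀ → |contactValue a| ≤ CY)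
    {ρmax : ℝ} (hρmax : 0 ≤ ρmax) (hρ : ∀ s ∈ Icc 0 t', ∀ x, ρ s x ≤ ρmax)
    (hguard : ∀ s ∈ Icc 0 t', ∀ x, ρ s x * σ ^ 3 ≤ η₀ / 2)
    (henergy : ∀ κ : ℝ, 0 < κ → ∃ K : ℝ, ∃ N₁ : ℕ, ∀ N, N₁ ≤ N →
      localGibbsLaw σ a₀ u₀ θ₀ N (Φ N) {z | K < ((N : ℝ) + 1)⁻¹ * configEnergy z} ≤ ENNReal.ofReal κ)
    (hESE : ∀ τ : ℝ, 0 < τ → ∀ χ : ℝ × UnitAddTorus (Fin 3) → ℝ, Continuous χ → ∀ g : ℝ → ℝ,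
      Continuous g → (∀ a, η₀ ≤ a → g a = 0) → ∀ η δ : ℝ, 0 < η → 0 < δ → ∃ r₀ : ℝ, 0 < r₀ ∧
      ∀ r : ℝ, 0 < r → r < r₀ → ∃ N₀ : ℕ, ∀ N : ℕ, N₀ ≤ N → ∀ k l : Fin 3,
        localGibbsLaw σ a₀ u₀ θ₀ N (Φ N) {z | η < |evenStat σ N (Φ N) τ χ g (evenMark k l) r z|} ≤
          ENNReal.ofReal δ)
    (hcap : ∀ η δ : ℝ, 0 < η → 0 < δ → ∃ r₀ : ℝ, 0 < r₀ ∧ ∀ r : ℝ, 0 < r → r < r₀ → ∃ N₀ : ℕ,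
      ∀ N : ℕ, N₀ ≤ N → localGibbsLaw σ a₀ u₀ θ₀ N (Φ N)
        {z | ∃ s ∈ Icc 0 t', ∃ x : T3, ρ s x + η < mollDensity r ((Φ N).flow s z) x} ≤ ENNReal.ofReal δ) :
    ∀ η : ℝ, 0 < η → ∀ κ : ℝ, 0 < κ → ∃ Δ : ℝ, 0 < Δ ∧ ∃ N₂ : ℕ, ∀ N, N₂ ≤ N →
      localGibbsLaw σ a₀ u₀ θ₀ N (Φ N) {z | η < hsDiameter σ N * ((N : ℝ) + 1)⁻¹ * (2⁻¹ *
        collisionalTransferFunctional (Torus.geometry (Fin 3)) (hsDiameter σ N)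
          (fun i _ pre post => ‖(post i).2 - (pre i).2‖) (fun r => (Φ N).flow r z) t (t + Δ))} ≤
        ENNReal.ofReal κ := by
  intro η hη κ hκ
  set CS : ℝ := (sphereMeasure : Measure (Metric.sphere (0 : V3) 1)).real univ with hCS
  have hCS0 : 0 ≤ CS := measureReal_nonneg
  have hCY0 : 0 ≤ CY := (abs_nonneg _).trans (hY 0 le_rfl hη₀.le)
  -- energy level
  obtain ⟨K, N₁, hK⟩ := henergy (κ / 5) (by positivity)
  set K' : ℝ := max K 1 with hK'def
  have hK'pos : 0 < K' := lt_of_lt_of_le one_pos (le_max_right _ _)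
  -- cap level, density bound, the constant of the Enskog term, the window
  set ηd : ℝ := min 1 (η₀ / (4 * σ ^ 3)) with hηd
  have hηd0 : 0 < ηd := lt_min one_pos (by positivity)
  set ρb : ℝ := ρmax + ηd with hρb
  have hρb0 : 0 ≤ ρb := by positivity
  set C₁ : ℝ := CY * (4 * CS * ρb) * (2 * K') with hC₁
  have hC₁0 : 0 ≤ C₁ := by positivity
  set Δ : ℝ := min ((t' - t) / 2) (η / (9 * σ ^ 3 * C₁ + 1)) with hΔdef
  have hden : 0 < 9 * σ ^ 3 * C₁ + 1 := by positivity
  have hΔ : 0 < Δ := lt_min (by linarith) (div_pos hη hden)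
  have hΔt : t + 2 * Δ ≤ t' := by
    have : Δ ≤ (t' - t) / 2 := min_le_left _ _
    linarith
  -- the weight and the cutoff
  obtain ⟨χΔ, hχc, hχ1, hχ0, hχind⟩ := exists_bump (t := t) hΔ
  obtain ⟨gc, hgc, hg0', hg1, hg0, hgle1⟩ := exists_cutoff hη₀
  have hgY : ∀ a, 0 ≤ a → |gc a * contactValue a| ≤ CY := by
    intro a ha
    by_cases hle : a ≤ η₀
    · rw [abs_mul]
      calc |gc a| * |contactValue a| ≤ 1 * CY :=
            mul_le_mul (by rw [abs_of_nonneg (hg0 a)]; exact hgle1 a) (hY a ha hle) (abs_nonneg _) zero_le_one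
        _ = CY := one_mul _
    · rw [hg0' a (le_of_lt (not_le.1 hle)), zero_mul, abs_zero]
      exact hCY0
  -- the crux and the cap at the chosen data
  have ht' : 0 < t' := lt_of_le_of_lt ht htt'
  obtain ⟨r₀, hr₀, HE⟩ := hESE t' ht' χΔ hχc gc hgc hg0' (η / 3) (κ / 5) (by positivity) (by positivity)
  obtain ⟨r₀', hr₀', HC⟩ := hcap ηd (κ / 5) hηd0 (by positivity)
  set r : ℝ := min (min r₀ r₀') (1 / 2) / 2 with hrdef
  have hr : 0 < r := by positivity
  have hm₁ : min (min r₀ r₀') (1 / 2) ≤ r₀ := (min_le_left _ _).trans (min_le_left _ _)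
  have hm₂ : min (min r₀ r₀') (1 / 2) ≤ r₀' := (min_le_left _ _).trans (min_le_right _ _)
  have hm₃ : min (min r₀ r₀') (1 / 2) ≤ 1 / 2 := min_le_right _ _
  have hrr₀ : r < r₀ := by rw [hrdef]; linarith
  have hrr₀' : r < r₀' := by rw [hrdef]; linarith
  have hr2 : r ≤ 1 / 2 := by rw [hrdef]; linarith
  obtain ⟨N₀, HE'⟩ := HE r hr hrr₀
  obtain ⟨N₀', HC'⟩ := HC r hr hrr₀'
  refine ⟨Δ, hΔ, max (max N₁ N₀) N₀', fun N hN => ?_⟩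
  have hN₁ : N₁ ≤ N := (le_max_left _ _).trans ((le_max_left _ _).trans hN)
  have hN₀ : N₀ ≤ N := (le_max_right _ _).trans ((le_max_left _ _).trans hN)
  have hN₀' : N₀' ≤ N := (le_max_right _ _).trans hN
  -- the bad events
  set P := localGibbsLaw σ a₀ u₀ θ₀ N (Φ N) with hP
  set A : Set (Config (N + 1) (Fin 3) T3) := {z | K' < ((N : ℝ) + 1)⁻¹ * configEnergy z} with hA
  set B : Set (Config (N + 1) (Fin 3) T3) :=
    {z | ∃ s ∈ Icc 0 t', ∃ x : T3, ρ s x + ηd < mollDensity r ((Φ N).flow s z) x} with hB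
  set E : Fin 3 → Set (Config (N + 1) (Fin 3) T3) := fun k =>
    {z | η / 3 < |evenStat σ N (Φ N) t' χΔ gc (evenMark k k) r z|} with hE
  have hsub : {z | η < hsDiameter σ N * ((N : ℝ) + 1)⁻¹ * (2⁻¹ *
      collisionalTransferFunctional (Torus.geometry (Fin 3)) (hsDiameter σ N)
        (fun i _ pre post => ‖(post i).2 - (pre i).2‖) (fun r => (Φ N).flow r z) t (t + Δ))} ⊆
      (Φ N).goodᶜ ∪ (A ∪ B ∪ ⋃ k, E k) := by
    intro z hz
    rw [mem_setOf_eq] at hz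
    by_contra hcon
    simp only [hA, hB, hE, mem_union, mem_compl_iff, mem_iUnion, mem_setOf_eq, not_or, not_not, not_lt,
      not_exists, not_and] at hcon
    obtain ⟨hzg, ⟨hK', hcapz⟩, hEz⟩ := hcon
    -- the domination by the collision sums
    have hg1z : ∀ s ∈ Ioc t (t + Δ), s ∈ collisionTimes (Torus.geometry (Fin 3)) (hsDiameter σ N)
        (fun s => (Φ N).flow s z) → ∀ i,
        gc (σ ^ 3 * mollDensity r ((Φ N).flow s z) ((Φ N).flow s z i).1) = 1 := by
      intro s hs _ i
      refine hg1 _ ?_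
      have hs' : s ∈ Icc 0 t' := ⟨ht.trans hs.1.le, hs.2.trans (by linarith)⟩
      have h1 : mollDensity r ((Φ N).flow s z) ((Φ N).flow s z i).1 ≤ ρ s ((Φ N).flow s z i).1 + ηd :=
        hcapz s hs' _
      have h2 : σ ^ 3 * ηd ≤ η₀ / 4 := by
        have : ηd ≤ η₀ / (4 * σ ^ 3) := min_le_right _ _
        rw [le_div_iff₀ (by positivity)] at this
        linarith
      calc σ ^ 3 * mollDensity r ((Φ N).flow s z) ((Φ N).flow s z i).1
          ≤ σ ^ 3 * (ρ s ((Φ N).flow s z i).1 + ηd) := mul_le_mul_of_nonneg_left h1 (by positivity)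
        _ = ρ s ((Φ N).flow s z i).1 * σ ^ 3 + σ ^ 3 * ηd := by ring
        _ ≤ η₀ / 2 + η₀ / 4 := add_le_add (hguard s hs' _) h2
        _ = 3 * η₀ / 4 := by ring
    have hdom := speedJump_window_le_sum_collisionSum hσ (Φ N) hzg (t₁ := t) (t₂ := t + Δ) (τ := t') ht
      (by linarith) (χ := χΔ) (fun s _ x => hχ0 s x) (fun s hs x => (hχ1 s ⟨hs.1.le, hs.2⟩ x).symm.le)
      (g := gc) hg0 (r := r) hg1z
    -- the Enskog terms
    have hEz' : ∀ k : Fin 3, collisionSum σ N (Φ N) t' χΔ gc (evenMark k k) r z ≤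
        η / 3 + σ ^ 3 * (C₁ * (3 * Δ)) := by
      intro k
      have h1 := hEz k
      rw [evenStat] at h1
      have h2 := abs_integral_enskogRate_le hσ (Φ N) k hr hr2 ht'.le (a := t - Δ) (b := t + 2 * Δ)
        (by linarith) hχind hgY hK'pos.le (z := z)
        (ρb := ρb) (fun s hs x => by linarith [hcapz s hs x, hρ s hs x])
        (fun s => by
          rw [(Φ N).configEnergy_flow hzg s]
          simpa [Nat.cast_add_one] using hK')
      have h3 : σ ^ 3 * |∫ s in Icc (0 : ℝ) t', enskogRate σ N χΔ gc (evenMark k k) r s ((Φ N).flow s z)| ≤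
          σ ^ 3 * (C₁ * (3 * Δ)) := by
        refine mul_le_mul_of_nonneg_left (h2.trans (le_of_eq ?_)) (by positivity)
        rw [hC₁]; ring
      have := abs_sub_abs_le_abs_sub (collisionSum σ N (Φ N) t' χΔ gc (evenMark k k) r z)
        (σ ^ 3 * ∫ s in Icc (0 : ℝ) t', enskogRate σ N χΔ gc (evenMark k k) r s ((Φ N).flow s z))
      rw [abs_mul, abs_of_nonneg (by positivity : (0 : ℝ) ≤ σ ^ 3)] at this
      linarith [le_abs_self (collisionSum σ N (Φ N) t' χΔ gc (evenMark k k) r z)]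
    have hsum : ∑ k : Fin 3, collisionSum σ N (Φ N) t' χΔ gc (evenMark k k) r z ≤
        3 * (η / 3 + σ ^ 3 * (C₁ * (3 * Δ))) := by
      calc ∑ k : Fin 3, collisionSum σ N (Φ N) t' χΔ gc (evenMark k k) r z
          ≤ ∑ _k : Fin 3, (η / 3 + σ ^ 3 * (C₁ * (3 * Δ))) := Finset.sum_le_sum fun k _ => hEz' k
        _ = _ := by rw [Finset.sum_const, Finset.card_univ, Fintype.card_fin]; simp; ring
    have hsmall : 9 * σ ^ 3 * C₁ * Δ < η := by
      have h1 : Δ ≤ η / (9 * σ ^ 3 * C₁ + 1) := min_le_right _ _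
      have h2 : 9 * σ ^ 3 * C₁ * Δ ≤ 9 * σ ^ 3 * C₁ * (η / (9 * σ ^ 3 * C₁ + 1)) :=
        mul_le_mul_of_nonneg_left h1 (by positivity)
      have h3 : 9 * σ ^ 3 * C₁ * (η / (9 * σ ^ 3 * C₁ + 1)) < η := by
        rw [mul_div_assoc', div_lt_iff₀ hden]; nlinarith
      linarith
    have : hsDiameter σ N * ((N : ℝ) + 1)⁻¹ * (2⁻¹ *
        collisionalTransferFunctional (Torus.geometry (Fin 3)) (hsDiameter σ N)
          (fun i _ pre post => ‖(post i).2 - (pre i).2‖) (fun r => (Φ N).flow r z) t (t + Δ)) < η := by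
      rw [show hsDiameter σ N * ((N : ℝ) + 1)⁻¹ * (2⁻¹ *
        collisionalTransferFunctional (Torus.geometry (Fin 3)) (hsDiameter σ N)
          (fun i _ pre post => ‖(post i).2 - (pre i).2‖) (fun r => (Φ N).flow r z) t (t + Δ)) =
        2⁻¹ * (hsDiameter σ N * ((N : ℝ) + 1)⁻¹ *
        collisionalTransferFunctional (Torus.geometry (Fin 3)) (hsDiameter σ N)
          (fun i _ pre post => ‖(post i).2 - (pre i).2‖) (fun r => (Φ N).flow r z) t (t + Δ)) by ring]
      nlinarith
    exact absurd hz (not_lt.2 this.le)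
  calc P {z | η < hsDiameter σ N * ((N : ℝ) + 1)⁻¹ * (2⁻¹ *
        collisionalTransferFunctional (Torus.geometry (Fin 3)) (hsDiameter σ N)
          (fun i _ pre post => ‖(post i).2 - (pre i).2‖) (fun r => (Φ N).flow r z) t (t + Δ))}
      ≤ P ((Φ N).goodᶜ ∪ (A ∪ B ∪ ⋃ k, E k)) := measure_mono hsub
    _ ≤ P (Φ N).goodᶜ + (P A + P B + ∑ k, P (E k)) := by
        refine (measure_union_le _ _).trans ?_
        gcongr
        refine (measure_union_le _ _).trans ?_
        gcongr
        · exact measure_union_le _ _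
        · exact measure_iUnion_fintype_le _ _
    _ ≤ 0 + (ENNReal.ofReal (κ / 5) + ENNReal.ofReal (κ / 5) + ∑ _k : Fin 3, ENNReal.ofReal (κ / 5)) := by
        rw [hP, localGibbsLaw_compl_good]
        gcongr with k _
        · exact (measure_mono fun z hz => lt_of_le_of_lt (le_max_left K 1) hz).trans (hK N hN₁)
        · exact HC' N hN₀'
        · exact HE' N hN₀ k k
    _ = ENNReal.ofReal κ := by
        rw [zero_add, Finset.sum_const, Finset.card_univ, Fintype.card_fin, nsmul_eq_mul,
          ← ENNReal.ofReal_add (by positivity) (by positivity), Nat.cast_ofNat,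
          ← ENNReal.ofReal_ofNat 3, ← ENNReal.ofReal_mul (by norm_num),
          ← ENNReal.ofReal_add (by positivity) (by positivity)]
        congr 1
        ring

/-- **The momentum input of the fixed-time upgrade, `hstat` discharged** (conjunct's frame + `t = 0`
LLN; `hequi_momentum_localGibbs` ∘ `hstat_of_evenStat_of_cap`, energy tightness from
`energy_tight_of_tendstoHydroFieldsAt_zero`): the normalised momentum observable of every `C¹` field
satisfies the hypothesis `hequi` of `tendsto_measure_fixedTime_of_timeAverage`. [folklore] -/
theorem hequi_momentum_of_evenStat_of_cap {σ : ℝ} (hσ : 0 < σ) (a₀ θ₀ : T3 → ℝ) (u₀ : T3 → V3)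
    (Φ : (N : ℕ) → HardSphereFlow (Torus.geometry (Fin 3)) (hsDiameter σ N) (N + 1))
    (ρ θ : ℝ → T3 → ℝ) (u : ℝ → T3 → V3)
    (h0 : TendstoHydroFieldsAt (fun N => localGibbsLaw σ a₀ u₀ θ₀ N (Φ N)) Φ ρ u θ 0)
    {J : T3 → V3} (hJ : Torus.IsContDiff 1 J) {t t' : ℝ} (ht : 0 ≤ t) (htt' : t < t') {Δ₀ : ℝ}
    (hΔ₀ : 0 < Δ₀) {η₀ : ℝ} (hη₀ : 0 < η₀) {CY : ℝ} (hY : ∀ a, 0 ≤ a → a ≤ η₀ → |contactValue a| ≤ CY)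
    {ρmax : ℝ} (hρmax : 0 ≤ ρmax) (hρ : ∀ s ∈ Icc 0 t', ∀ x, ρ s x ≤ ρmax)
    (hguard : ∀ s ∈ Icc 0 t', ∀ x, ρ s x * σ ^ 3 ≤ η₀ / 2)
    (hESE : ∀ τ : ℝ, 0 < τ → ∀ χ : ℝ × UnitAddTorus (Fin 3) → ℝ, Continuous χ → ∀ g : ℝ → ℝ,
      Continuous g → (∀ a, η₀ ≤ a → g a = 0) → ∀ η δ : ℝ, 0 < η → 0 < δ → ∃ r₀ : ℝ, 0 < r₀ ∧
      ∀ r : ℝ, 0 < r → r < r₀ → ∃ N₀ : ℕ, ∀ N : ℕ, N₀ ≤ N → ∀ k l : Fin 3,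
        localGibbsLaw σ a₀ u₀ θ₀ N (Φ N) {z | η < |evenStat σ N (Φ N) τ χ g (evenMark k l) r z|} ≤
          ENNReal.ofReal δ)
    (hcap : ∀ η δ : ℝ, 0 < η → 0 < δ → ∃ r₀ : ℝ, 0 < r₀ ∧ ∀ r : ℝ, 0 < r → r < r₀ → ∃ N₀ : ℕ,
      ∀ N : ℕ, N₀ ≤ N → localGibbsLaw σ a₀ u₀ θ₀ N (Φ N)
        {z | ∃ s ∈ Icc 0 t', ∃ x : T3, ρ s x + η < mollDensity r ((Φ N).flow s z) x} ≤ ENNReal.ofReal δ) :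
    ∀ δ : ℝ, 0 < δ → ∀ κ : ℝ, 0 < κ → ∃ Δ : ℝ, 0 < Δ ∧ Δ ≤ Δ₀ ∧ ∃ N₀ : ℕ, ∀ N, N₀ ≤ N →
      ∀ s ∈ Ioo t (t + Δ),
        localGibbsLaw σ a₀ u₀ θ₀ N (Φ N)
          {z | δ < |((N : ℝ) + 1)⁻¹ * momentumObservable J ((Φ N).flow s z) -
            ((N : ℝ) + 1)⁻¹ * momentumObservable J ((Φ N).flow t z)|} ≤ ENNReal.ofReal κ := by
  refine hequi_momentum_localGibbs hσ a₀ θ₀ u₀ Φ ρ θ u h0 hJ t hΔ₀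
    (hstat_of_evenStat_of_cap hσ a₀ θ₀ u₀ Φ ρ ht htt' hη₀ hY hρmax hρ hguard (fun κ hκ => ?_) hESE hcap)
  obtain ⟨K, N₁, hK⟩ := energy_tight_of_tendstoHydroFieldsAt_zero σ a₀ θ₀ u₀ Φ ρ θ u h0 0 κ hκ
  refine ⟨K, N₁, fun N hN => le_trans (measure_mono fun z hz => ?_)
    ((measure_union_le ((Φ N).goodᶜ) {z | K < empiricalEnergyField ((Φ N).flow 0 z) fun _ => 1}).trans
      ?_)⟩
  · simp only [mem_setOf_eq, mem_union, mem_compl_iff] at hz ⊢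
    by_cases hg : z ∈ (Φ N).good
    · right
      rw [(Φ N).flow_zero z hg, empiricalEnergyField_one_eq]
      simpa [Nat.cast_add_one] using hz
    · exact Or.inl hg
  · rw [localGibbsLaw_compl_good, zero_add]
    exact hK N hN

end Summit.AtomisticToContinuum.HydrodynamicLimit.Theorems.JParityClosureSpeedJumpWindow

end
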